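import Mathlib

/-!
# `PermanentalConeHard` (stmt-ValiantsHypothesis-8654), line `birth` — facet-contact obstruction III

Route `PermanentalCones` of `ValiantsHypothesis`, crux `PermanentalConeHard`, stub
`stub_knapsackContactSpan`: the finite-combinatorics part of the NO-GO theorem for the
"facet-contact" strategy.

Let `S ⊆ Fin n` with `#S = 2k+1`, `k ≥ 1`, and let
`g A = c₀ + ∑_{i ∈ A} c₁ i + ∑_{i < j, i j ∈ A} c₂ i j`, a multilinear function of degree `≤ 2` of
the indicator vector of `A`.  If `g A = 0` whenever `#(A ∩ S) ∈ {k, k+1}`, then `g` is a multiple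
`t • f_S` of the knapsack quadratic `f_S A = (#(A ∩ S) - k) (#(A ∩ S) - k - 1)`; in coefficients:
`c₀ = t k (k+1)`, `c₁ = -2kt` on `S` and `0` off `S`, `c₂ = 2t` on pairs inside `S` and `0` on all
other pairs `i < j`.

Proof (elementary, in full below).  Write `e i j = [i<j] c₂ i j + [j<i] c₂ j i` for the
symmetrised pair coefficient.  The workhorse is the insertion identity
`g (insert i B) = g B + c₁ i + ∑_{b ∈ B} e i b` for `i ∉ B` (`KnapsackSpan.quad_insert`), whence the
second difference `e i j = g (B ∪ {i,j}) - g (B ∪ {j}) - g (B ∪ {i}) + g B`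
(`KnapsackSpan.second_diff`).  We substitute `k ↦ k+1`, so `#S = 2k+3` and the admissible
intersection sizes are `k+1`, `k+2`.
* A pair with a point off `S` has `e = 0`: take `B` a `(k+1)`-subset of `S` avoiding the pair; all
  four sets in the second difference are admissible (`KnapsackSpan.e_eq_zero_of_not_mem`); then
  `c₁ = 0` off `S` from `g (B ∪ {i}) - g B = c₁ i` (`KnapsackSpan.c₁_eq_zero_of_not_mem`).
* Inside `S`: for a `k`-subset `T ⊆ S` and `i ≠ j ∈ S \ T` the second difference gives
  `e i j = g T` (`KnapsackSpan.e_eq_g`); any two pairs of `S` avoid a common `k`-subset of `S`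
  (`#S - 4 ≥ k` when `k ≥ 1`, trivial when `k = 0`), so `e` is a constant `γ` on pairs of `S` and
  `g T = γ` on `k`-subsets (`KnapsackSpan.e_const`).
* `c₁ j = -(k+1) γ` on `S` from `g (T ∪ {j}) = 0` (`KnapsackSpan.c₁_eq_of_mem`), and
  `g T = g ∅ - #T (k+1) γ + #T (#T - 1) γ / 2` for `T ⊆ S` by induction (`KnapsackSpan.g_eq`),
  which at an admissible `(k+1)`-subset gives `c₀ = g ∅ = γ (k+1) (k+2) / 2`; put `t = γ / 2`.

References: folklore (the affine span of two consecutive slices of the cube inside the space of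
multilinear quadratics; the set-up of Grigoriev's knapsack degree lower bound).  Every step is
proved in full here.
-/

set_option linter.dupNamespace false

namespace Summit.ValiantsHypothesis.ValiantsHypothesis.Theorems.PermanentalConesPermanentalConeHard

open Finset

namespace KnapsackSpan

variable {n : ℕ}

/-- The insertion identity for the degree-`≤ 2` multilinear function
`A ↦ c₀ + ∑_{a ∈ A} c₁ a + ∑_{a < b ∈ A} c₂ a b`: inserting a fresh point `i` adds
`c₁ i + ∑_{b ∈ B} ([i<b] c₂ i b + [b<i] c₂ b i)`. [folklore] -/
theorem quad_insert (c₀ : ℝ) (c₁ : Fin n → ℝ) (c₂ : Fin n → Fin n → ℝ) (B : Finset (Fin n))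
    {i : Fin n} (hi : i ∉ B) :
    c₀ + (∑ a ∈ insert i B, c₁ a) +
        (∑ a ∈ insert i B, ∑ b ∈ insert i B, if a < b then c₂ a b else 0) =
      c₀ + (∑ a ∈ B, c₁ a) + (∑ a ∈ B, ∑ b ∈ B, if a < b then c₂ a b else 0) + c₁ i +
        ∑ b ∈ B, ((if i < b then c₂ i b else 0) + (if b < i then c₂ b i else 0)) := by
  simp only [sum_insert hi, lt_self_iff_false, if_false, sum_add_distrib]
  ring

variable {k : ℕ} {S : Finset (Fin n)} {g : Finset (Fin n) → ℝ} {c₁ : Fin n → ℝ}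
  {e : Fin n → Fin n → ℝ}

/-- Second difference of a function satisfying the insertion identity: for `i ≠ j` both outside
`B`, `e i j = g (B ∪ {i, j}) - g (B ∪ {j}) - g (B ∪ {i}) + g B`. [folklore] -/
theorem second_diff (hins : ∀ i B, i ∉ B → g (insert i B) = g B + c₁ i + ∑ b ∈ B, e i b)
    {i j : Fin n} {B : Finset (Fin n)} (hij : i ≠ j) (hi : i ∉ B) (hj : j ∉ B) :
    e i j = g (insert i (insert j B)) - g (insert j B) - g (insert i B) + g B := by
  have hi' : i ∉ insert j B := by simp [hij, hi]
  rw [hins i (insert j B) hi', hins j B hj, hins i B hi, sum_insert hj]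
  ring

/-- A `k`-subset of `S` (`#S = 2k+3`) avoiding at most four prescribed points. [folklore] -/
theorem exists_avoid (hS : S.card = 2 * k + 3) (F : Finset (Fin n)) (hF : F.card ≤ 4) :
    ∃ T ⊆ S, T.card = k ∧ ∀ x ∈ F, x ∉ T := by
  obtain ⟨T, hT, hTk⟩ := exists_subset_card_eq (s := S \ F) (n := k)
    (le_trans (by omega) (le_card_sdiff F S))
  exact ⟨T, hT.trans sdiff_subset, hTk, fun x hx hxT => (mem_sdiff.mp (hT hxT)).2 hx⟩

/-- Two distinct points of `S` (`#S = 2k+3`) outside a `k`-subset `T ⊆ S`. [folklore] -/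
theorem exists_two (hS : S.card = 2 * k + 3) {T : Finset (Fin n)} (hTS : T ⊆ S)
    (hTk : T.card = k) : ∃ a ∈ S, ∃ b ∈ S, a ∉ T ∧ b ∉ T ∧ a ≠ b := by
  have h1 : 1 < (S \ T).card := by rw [card_sdiff_of_subset hTS]; omega
  obtain ⟨a, ha, b, hb, hab⟩ := one_lt_card.mp h1
  rw [mem_sdiff] at ha hb
  exact ⟨a, ha.1, b, hb.1, ha.2, hb.2, hab⟩

/-- Step 1–2: a pair `{i, j}` with `i ∉ S` has vanishing symmetrised coefficient `e i j`: the
second difference over a `(k+1)`-subset of `S ∖ {j}` only involves admissible sets. [folklore] -/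
theorem e_eq_zero_of_not_mem (hS : S.card = 2 * k + 3)
    (hval : ∀ A, (A ∩ S).card = k + 1 ∨ (A ∩ S).card = k + 2 → g A = 0)
    (hins : ∀ i B, i ∉ B → g (insert i B) = g B + c₁ i + ∑ b ∈ B, e i b)
    {i j : Fin n} (hi : i ∉ S) (hij : i ≠ j) : e i j = 0 := by
  obtain ⟨T, hT, hTk⟩ := exists_subset_card_eq (s := S.erase j) (n := k + 1)
    (le_trans (by omega) pred_card_le_card_erase)
  have hTS : T ⊆ S := hT.trans (erase_subset j S)
  have hjT : j ∉ T := fun h => (mem_erase.mp (hT h)).1 rfl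
  have hiT : i ∉ T := fun h => hi (hTS h)
  have hTv : (T ∩ S).card = k + 1 ∨ (T ∩ S).card = k + 2 :=
    Or.inl (by rw [inter_eq_left.mpr hTS, hTk])
  have hjv : (insert j T ∩ S).card = k + 1 ∨ (insert j T ∩ S).card = k + 2 := by
    by_cases hj : j ∈ S
    · exact Or.inr (by rw [inter_eq_left.mpr (insert_subset hj hTS), card_insert_of_notMem hjT, hTk])
    · exact Or.inl (by rw [insert_inter_of_notMem hj, inter_eq_left.mpr hTS, hTk])
  rw [second_diff hins hij hiT hjT, hval _ (by rwa [insert_inter_of_notMem hi]), hval _ hjv,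
    hval _ (by rwa [insert_inter_of_notMem hi]), hval _ hTv]
  ring

/-- Step 2: `c₁ i = 0` for `i ∉ S`, from `g (T ∪ {i}) - g T = c₁ i + ∑_{t ∈ T} e i t = c₁ i` for an
admissible `(k+1)`-subset `T ⊆ S`. [folklore] -/
theorem c₁_eq_zero_of_not_mem (hS : S.card = 2 * k + 3)
    (hval : ∀ A, (A ∩ S).card = k + 1 ∨ (A ∩ S).card = k + 2 → g A = 0)
    (hins : ∀ i B, i ∉ B → g (insert i B) = g B + c₁ i + ∑ b ∈ B, e i b)
    {i : Fin n} (hi : i ∉ S) : c₁ i = 0 := by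
  obtain ⟨T, hTS, hTk⟩ := exists_subset_card_eq (s := S) (n := k + 1) (by omega)
  have hiT : i ∉ T := fun h => hi (hTS h)
  have hTv : (T ∩ S).card = k + 1 ∨ (T ∩ S).card = k + 2 :=
    Or.inl (by rw [inter_eq_left.mpr hTS, hTk])
  have h0 : ∑ b ∈ T, e i b = 0 :=
    sum_eq_zero fun b hb => e_eq_zero_of_not_mem hS hval hins hi (ne_of_mem_of_not_mem hb hiT).symm
  have h := hins i T hiT
  rw [hval _ (by rwa [insert_inter_of_notMem hi]), hval _ hTv, h0] at h
  linarith

/-- Step 3: inside `S`, for a `k`-subset `T ⊆ S` and `i ≠ j ∈ S ∖ T`, the second difference gives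
`e i j = g T` (the three other sets are admissible). [folklore] -/
theorem e_eq_g (hval : ∀ A, (A ∩ S).card = k + 1 ∨ (A ∩ S).card = k + 2 → g A = 0)
    (hins : ∀ i B, i ∉ B → g (insert i B) = g B + c₁ i + ∑ b ∈ B, e i b)
    {T : Finset (Fin n)} (hTS : T ⊆ S) (hTk : T.card = k) {i j : Fin n} (hi : i ∈ S)
    (hj : j ∈ S) (hiT : i ∉ T) (hjT : j ∉ T) (hij : i ≠ j) : e i j = g T := by
  have hi' : i ∉ insert j T := by simp [hij, hiT]
  have hjTS : insert j T ⊆ S := insert_subset hj hTS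
  have h1 : g (insert j T) = 0 :=
    hval _ (Or.inl (by rw [inter_eq_left.mpr hjTS, card_insert_of_notMem hjT, hTk]))
  have h2 : g (insert i T) = 0 :=
    hval _ (Or.inl (by
      rw [inter_eq_left.mpr (insert_subset hi hTS), card_insert_of_notMem hiT, hTk]))
  have h3 : g (insert i (insert j T)) = 0 :=
    hval _ (Or.inr (by
      rw [inter_eq_left.mpr (insert_subset hi hjTS), card_insert_of_notMem hi',
        card_insert_of_notMem hjT, hTk]))
  rw [second_diff hins hij hiT hjT, h1, h2, h3]
  ring

/-- Step 4: the symmetrised pair coefficient is a constant `γ` on pairs of `S`, and `g T = γ` for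
every `k`-subset `T ⊆ S` (any two pairs of `S` avoid a common `k`-subset of `S`). [folklore] -/
theorem e_const (hS : S.card = 2 * k + 3)
    (hval : ∀ A, (A ∩ S).card = k + 1 ∨ (A ∩ S).card = k + 2 → g A = 0)
    (hins : ∀ i B, i ∉ B → g (insert i B) = g B + c₁ i + ∑ b ∈ B, e i b) :
    ∃ γ : ℝ, (∀ i ∈ S, ∀ j ∈ S, i ≠ j → e i j = γ) ∧ ∀ T ⊆ S, T.card = k → g T = γ := by
  obtain ⟨T₀, hT₀S, hT₀k, -⟩ := exists_avoid hS ∅ (by simp)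
  obtain ⟨a, ha, b, hb, haT₀, hbT₀, hab⟩ := exists_two hS hT₀S hT₀k
  have key : ∀ i ∈ S, ∀ j ∈ S, i ≠ j → e i j = g T₀ := by
    intro i hi j hj hij
    obtain ⟨T, hTS, hTk, hT⟩ := exists_avoid hS {i, j, a, b} card_le_four
    rw [e_eq_g hval hins hTS hTk hi hj (hT i (by simp)) (hT j (by simp)) hij,
      ← e_eq_g hval hins hTS hTk ha hb (hT a (by simp)) (hT b (by simp)) hab,
      e_eq_g hval hins hT₀S hT₀k ha hb haT₀ hbT₀ hab]
  refine ⟨g T₀, key, fun T hTS hTk => ?_⟩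
  obtain ⟨a', ha', b', hb', haT, hbT, hab'⟩ := exists_two hS hTS hTk
  rw [← e_eq_g hval hins hTS hTk ha' hb' haT hbT hab']
  exact key a' ha' b' hb' hab'

/-- Step 5: `c₁ j = -(k+1) γ` for `j ∈ S`, from `0 = g (T ∪ {j}) = g T + c₁ j + ∑_{t ∈ T} e j t`
for a `k`-subset `T ⊆ S ∖ {j}`. [folklore] -/
theorem c₁_eq_of_mem (hS : S.card = 2 * k + 3)
    (hval : ∀ A, (A ∩ S).card = k + 1 ∨ (A ∩ S).card = k + 2 → g A = 0)
    (hins : ∀ i B, i ∉ B → g (insert i B) = g B + c₁ i + ∑ b ∈ B, e i b) {γ : ℝ}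
    (hγe : ∀ i ∈ S, ∀ j ∈ S, i ≠ j → e i j = γ) (hγg : ∀ T ⊆ S, T.card = k → g T = γ)
    {j : Fin n} (hj : j ∈ S) : c₁ j = -((k + 1 : ℝ) * γ) := by
  obtain ⟨T, hTS, hTk, hT⟩ := exists_avoid hS {j} (by simp)
  have hjT : j ∉ T := hT j (mem_singleton_self j)
  have h1 : g (insert j T) = 0 :=
    hval _ (Or.inl (by
      rw [inter_eq_left.mpr (insert_subset hj hTS), card_insert_of_notMem hjT, hTk]))
  have h2 : ∑ b ∈ T, e j b = k * γ := by
    rw [sum_congr rfl fun b hb => hγe j hj b (hTS hb) (ne_of_mem_of_not_mem hb hjT).symm,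
      sum_const, nsmul_eq_mul, hTk]
  have h := hins j T hjT
  rw [h1, hγg T hTS hTk, h2] at h
  linarith

/-- Step 6: for `T ⊆ S`, `g T = g ∅ - #T (k+1) γ + #T (#T - 1) γ / 2`, by induction on `T` using
the insertion identity with `c₁ = -(k+1) γ` on `S` and `e = γ` on pairs of `S`. [folklore] -/
theorem g_eq (hins : ∀ i B, i ∉ B → g (insert i B) = g B + c₁ i + ∑ b ∈ B, e i b) {γ : ℝ}
    (hγe : ∀ i ∈ S, ∀ j ∈ S, i ≠ j → e i j = γ) (hc₁ : ∀ j ∈ S, c₁ j = -((k + 1 : ℝ) * γ))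
    {T : Finset (Fin n)} (hTS : T ⊆ S) :
    g T = g ∅ - T.card * ((k + 1 : ℝ) * γ) + T.card * (T.card - 1) / 2 * γ := by
  refine Finset.induction_on' (motive := fun T : Finset (Fin n) =>
    g T = g ∅ - T.card * ((k + 1 : ℝ) * γ) + T.card * (T.card - 1) / 2 * γ) T (by simp) ?_
  intro a s haT hsT has ih
  have haS : a ∈ S := hTS haT
  have h2 : ∑ b ∈ s, e a b = s.card * γ := by
    rw [sum_congr rfl fun b hb => hγe a haS b (hTS (hsT hb)) (ne_of_mem_of_not_mem hb has).symm,
      sum_const, nsmul_eq_mul]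
  rw [hins a s has, ih, hc₁ a haS, h2, card_insert_of_notMem has]
  push_cast
  ring

end KnapsackSpan

open KnapsackSpan in
/-- **Facet-contact obstruction III (knapsack contact span).**  Let `S ⊆ Fin n` with
`#S = 2k+1`, `k ≥ 1`.  If the degree-`≤ 2` multilinear function
`A ↦ c₀ + ∑_{i ∈ A} c₁ i + ∑_{i<j ∈ A} c₂ i j` vanishes on every `A` with `#(A ∩ S) ∈ {k, k+1}`,
then it is `t` times the knapsack quadratic `(#(A ∩ S) - k) (#(A ∩ S) - k - 1)`:
`c₀ = t k (k+1)`, `c₁ = -2kt` on `S` and `0` off `S`, and `c₂ i j = 2t` for `i < j` both in `S`,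
`0` for the other pairs `i < j`. [folklore] -/
theorem stub_knapsackContactSpan : ∀ (n k : ℕ) (S : Finset (Fin n)), 1 ≤ k → S.card = 2 * k + 1 → ∀ (c₀ : ℝ) (c₁ : Fin n → ℝ) (c₂ : Fin n → Fin n → ℝ), (∀ A : Finset (Fin n), ((A ∩ S).card = k ∨ (A ∩ S).card = k + 1) → c₀ + (∑ i ∈ A, c₁ i) + (∑ i ∈ A, ∑ j ∈ A, if i < j then c₂ i j else 0) = 0) → ∃ t : ℝ, c₀ = t * ((k : ℝ) * ((k : ℝ) + 1)) ∧ (∀ i, c₁ i = if i ∈ S then -(2 * (k : ℝ) * t) else 0) ∧ (∀ i j : Fin n, i < j → c₂ i j = if i ∈ S ∧ j ∈ S then 2 * t else 0) := by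
  intro n k S hk hS c₀ c₁ c₂ hval
  obtain ⟨k, rfl⟩ : ∃ k', k = k' + 1 := ⟨k - 1, by omega⟩
  obtain ⟨g, hg⟩ : ∃ g : Finset (Fin n) → ℝ, ∀ A, g A =
      c₀ + (∑ i ∈ A, c₁ i) + (∑ i ∈ A, ∑ j ∈ A, if i < j then c₂ i j else 0) :=
    ⟨_, fun A => rfl⟩
  obtain ⟨e, he⟩ : ∃ e : Fin n → Fin n → ℝ, ∀ i j, e i j =
      (if i < j then c₂ i j else 0) + (if j < i then c₂ j i else 0) :=
    ⟨_, fun i j => rfl⟩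
  have hS' : S.card = 2 * k + 3 := by omega
  have hval' : ∀ A, (A ∩ S).card = k + 1 ∨ (A ∩ S).card = k + 2 → g A = 0 :=
    fun A hA => (hg A).trans (hval A (by omega))
  have hins : ∀ i B, i ∉ B → g (insert i B) = g B + c₁ i + ∑ b ∈ B, e i b := by
    intro i B hi
    simp only [hg, he]
    exact quad_insert c₀ c₁ c₂ B hi
  obtain ⟨γ, hγe, hγg⟩ := e_const hS' hval' hins
  have hc₁ : ∀ j ∈ S, c₁ j = -((k + 1 : ℝ) * γ) :=
    fun j hj => c₁_eq_of_mem hS' hval' hins hγe hγg hj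
  have h0 : g ∅ = c₀ := by simp [hg]
  obtain ⟨T₁, hT₁S, hT₁k⟩ := exists_subset_card_eq (s := S) (n := k + 1) (by omega)
  have hgT₁ : g T₁ = 0 := hval' _ (Or.inl (by rw [inter_eq_left.mpr hT₁S, hT₁k]))
  have hc₀ := g_eq hins hγe hc₁ hT₁S
  rw [hgT₁, h0, hT₁k] at hc₀
  push_cast at hc₀
  refine ⟨γ / 2, ?_, fun i => ?_, fun i j hij => ?_⟩
  · push_cast
    linear_combination -hc₀
  · split_ifs with hi
    · rw [hc₁ i hi]
      push_cast
      ring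
    · exact c₁_eq_zero_of_not_mem hS' hval' hins hi
  · have heij : e i j = c₂ i j := by
      rw [he, if_pos hij, if_neg (not_lt.mpr hij.le), add_zero]
    rw [← heij]
    split_ifs with h
    · rw [hγe i h.1 j h.2 hij.ne]
      ring
    · by_cases hi : i ∈ S
      · have hj : j ∉ S := fun hj => h ⟨hi, hj⟩
        have hsymm : e i j = e j i := by rw [he, he, add_comm]
        rw [hsymm]
        exact e_eq_zero_of_not_mem hS' hval' hins hj hij.ne'
      · exact e_eq_zero_of_not_mem hS' hval' hins hi hij.ne

end Summit.ValiantsHypothesis.ValiantsHypothesis.Theorems.PermanentalConesPermanentalConeHard
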